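/-
Copyright: statement-level skeleton of a published paper (lit-balaban cell, Phase-2 proof seat p25, gen 20). No proof
claims beyond what the kernel checks below.
-/
import Literature.MathematicalPhysics.QuantumFieldTheory.BalabanImbrieJaffe1984to88.BIJ88WalkCovarianceSplit310
import Literature.MathematicalPhysics.QuantumFieldTheory.BalabanImbrieJaffe1984to88.BIJ88WalkIneq312RemainderBdry
import Literature.MathematicalPhysics.QuantumFieldTheory.BalabanImbrieJaffe1984to88.BIJ88WalkLocatedDisplay312
import Literature.MathematicalPhysics.QuantumFieldTheory.BalabanImbrieJaffe1984to88.BIJ88WalkRemainderMoments312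

/-!
# `BalabanImbrieJaffe1984to88.BIJ88WalkIneq312CovSplit` — T. Bałaban, J. Imbrie, A. Jaffe, *Effective action and
cluster properties of the abelian Higgs model*, Commun. Math. Phys. **114** (1988) 257–315 [BalabanImbrieJaffe1988],
§5.14 pp. 310, 312 [PDF 54, 56], verbatim (x2 renders `lit-balaban-r16/renders/cmp114/original-p054-x2.png`,
`…-p056-x2.png`, re-read this session): *"We give random walk expansions for the propagators C^{(k)}_{Λ₁₂^{(k)}},
C^{(k)}_{Λ₁₂^{(k)}}(u_{k+1}) produced in this step. The leading terms, with only propagators C^{(k)}_{Λ₁₂^{(k)},loc},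
C^{(k)}_{Λ₁₂^{(k)},loc}(u_{k+1}), we transform further. The others, localized in region X, have a factor of
e^{−cr(e_k)|X|}."* (p. 310) and *"These considerations lead to the following estimate: |G_k(X)| ≦
c(F(X))(e^β(L^kε/ε₀)^{1/4−α})^{β′|X∖∪_cX_c|} × Π_{X_{σ_1} ⊂ X : dist(X_{σ_1}, Λ₁₂^{(k)c}) < r(e_k)} [c(L^kε)^{−m(c)}e^{−m′(c)}]"*
(p. 312) — **THE HEAD THEOREM OF ROW C2.Claim@312 WITH ITS COVARIANCE PIECES INSTANTIATED ON THE MODEL OF RECORD**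
(p25 gen 20; a MEMBER: the head theorem `BIJ88WalkIneq312RemainderBdry.ineq312_remainder_bdry` (r16 v2.284) and the
located display `BIJ88WalkLocatedDisplay312.located_display_fieldLaw` are USED BY NAME with the abstract finite family
of covariance pieces `Cov p` REPLACED by the two pieces of `BIJ88WalkCovarianceSplit310.covSplit blk Δ W R` — the walks
of fewer than `R` cube-steps `C_{loc,R}` (non-triggering, `trig = false`, `reg = ∅`, bracket bound `B′_loc`) and the
walks of at least `R` steps `C_{tail,R}` (triggering: a contraction through it sets the component aside as a remainder
*"random-walk term"*, `reg = ∅`, bracket bound `B′_tail`, i.e. print's factor `e^{−cr(e_k)}` is `θ_w ≥ B′_tail`)).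

What the instantiation DISCHARGES of the head's clause C1 (r16 v2.284: *"C1 covariance/locality"*): `P`, `Cov`, `trig`,
`ρ ≡ 1`, `ρ₀ = 2`, `reg ≡ ∅`, `Dir = {u : ‖u‖_∞ ≤ R_∞ ∧ Σ_x|u x| ≤ R₁}`, `B′ p = ‖Cov p‖·R_∞·max(R₁,1)` (the
`ℓ^∞`-operator norm) with `hB`/`hBf`/`hBz` PROVED (`BIJ88WalkCovarianceSplit310.abs_mulVec_dotProduct_le`), `hloc`/`hwalk`
reduced to the two numeric hypotheses `B′_loc ≤ B_ℓ`, `B′_tail ≤ θ_w`, `hρ₀` PROVED, and — for the identity — `hCov`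
PROVED (`sum_covSplit`).  What REMAINS a letter: `B_ℓ ≥ B′_loc` and `θ_w ≥ B′_tail` as numbers (the sizes
`‖C_{loc,R}‖`, `‖C_{tail,R}‖ ≤ ‖T^R‖‖prec⁻¹‖` are the propagator estimates print imports — *"factor of e^{−cr(e_k)}"*),
the locality count `N₀` of the vertex legs (`hN`, print's local `V^{(k)}(Y)`), and the head's other clauses C2 (`c_V`,
`θ_v`, `hvert`), C3 (`K_χ`, `η_χ`, `Λ_O`, `hE`), C4 (`hbeat`), C5 (`bdry`) verbatim.

* §1 brackets by norm: `bracket_le_of_mem`, `norm_mulVec_le_of_mem`;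
* §2 **`ineq312_remainder_bdry_covSplit`** — the head's conclusion
  `Ineq312 remSys (remAt(covSplit R)/Z) (K_χ Λ_O (max 1 (2(Φ₀(O)+N₀)))^{Φ₀(O)}) (Π_{j∈O∩bdry}B_ℓ^{|obs j|}) nfree θ 1`;
* §3 **`located_display_fieldLaw_covSplit`** — the located display on the law for these pieces with `hCov` DISCHARGED:
  `𝔼[Π_{j∈K}Π_{w∈obs j}(Φ·w) · χ e^{−V}] = Σ_{O⊆K}(Σ_π Π_Q flBlock Q)·Σ_𝒳 remAt(covSplit R)(O,𝒳)/Z`;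
* §4 **`ineq312_remainder_bdry_covSplit_of_sup`** — §2 with the expectation clause `hE` REPLACED by the sup letter alone
  (`|(Π_D∂)χ·e^{−V}| ≤ K_χΠ_{z∈D}(η_χ‖z‖)`): the moment letter is `BIJ88WalkRemainderMoments312.remainder_moment_le` with
  `μ_* = ‖prec⁻¹‖·‖ℱ|_W‖_∞·R₁`, `v_* = ‖prec⁻¹‖·R_∞·R₁` DERIVED from the norms (`moment_letters_of_norm`);
* §5 KERNEL NON-VACUITY CERTIFICATE `ineq312_remainder_bdry_covSplit_of_sup_toy`: every binder of §4 inhabited and every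
  hypothesis discharged on the one-site toy of `BIJ88WalkIneq312NonVacuity` (genuine leg, `χ ≡ 1`, `R = 1`; the tail piece
  is `0` on one cube, `covSplit_true_toy_eq_zero`).

statement-level skeleton of published theorems with citation tags; proofs where landed; nothing here is a claim
about the Yang–Mills mass gap

PDF held: `paper:balaban1988-cmp114-bij-abelian-higgs-effective-action` (journal page = PDF page + 256); pp. 310, 312
= PDF 54, 56 (x2 renders re-read this session, 2026-08-23).

CITATION HEADER (lean-in-tree rule).  lit-balaban cell (HOME `run/shared/lean/pub/lit-balaban/`), Phase 2, seat p25
gen 20; row **C2.Claim@312** of `HOME/lit-balaban-r16/ROWS-C2-part2.md` (owner r16, referee ref-5; head theorem of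
record UNCHANGED and USED BY NAME; this file is a MEMBER — clause C1 instantiated on the model of record).  Nothing
restated.
HONEST SCOPE: as in `BIJ88WalkCovarianceSplit310` ((a) walk-length cut-off `R` ↔ print's `O(r(e_k))`; (b) one tail piece,
`reg ≡ ∅` — print's per-region `e^{−cr(e_k)|X|}` bookkeeping not reproduced, so the tail contributes `θ_w` but no cubes to
`θ^{nfree}`; (c) `‖T^R‖`, `‖prec⁻¹‖`, `‖D⁻¹‖` are inputs) and in the head ((H1)–(H5)); `Dir` by norms is a CHOICE (any
set containing the observable and vertex legs works).  NOT summit progress; NOT continuum; NOT Clay.  Imports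
`BIJ88WalkCovarianceSplit310`, `BIJ88WalkIneq312RemainderBdry`, `BIJ88WalkLocatedDisplay312`, `BIJ88WalkRemainderMoments312`;
modifies nothing.
-/

noncomputable section

namespace Literature.MathematicalPhysics.QuantumFieldTheory.BalabanImbrieJaffe1984to88.BIJ88WalkIneq312CovSplit

open Classical MeasureTheory Matrix Finset
open scoped BigOperators Matrix.Norms.Operator
open Literature.Probability.LatticeModels (setPartitions)
open Literature.MathematicalPhysics.QuantumFieldTheory.Balaban1983to89
open B2Eq228Conditioning (weight source)
open BIJ88PolymerRep5134 (corner)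
open BIJ88PolymerRep5134Gauss (prec src)
open BIJ88SlotMomentsGauss308 (fieldLaw)
open BIJ88VertexIbp311 (vexp)
open BIJ88WickDerivatives305 (dlist)
open BIJ88VertexComponents311 (maxArity)
open BIJ88WalkRun311 BIJ88WalkExpansion311 BIJ88WalkLabelPartition312 BIJ88WalkRemainderActivity312
  BIJ88WalkIneq312Remainder BIJ88WalkIneq312RemainderBdry BIJ88WalkLocatedDisplay312 BIJ88WalkCovarianceSplit310
  BIJ88WalkResummationDisplay312 BIJ88WalkRemainderMoments312

/-! ## §1  Directions by norm: the bracket bounds -/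

section Dir

variable {n : Type} [Fintype n]

/-- a bracket through a piece between two admissible directions: `|(Mu)·w| ≤ ‖M‖·R_∞·max(R₁,1)` for `‖u‖_∞ ≤ R_∞`,
`Σ|w| ≤ R₁`. [cite: BalabanImbrieJaffe1988, §5.14 p.310] -/
theorem bracket_le_of_mem (M : Matrix n n ℝ) {Rinf R1 : ℝ} (hRinf : 0 ≤ Rinf) {u w : n → ℝ} (hu : ‖u‖ ≤ Rinf)
    (hw : ∑ x, |w x| ≤ R1) : |(M *ᵥ u) ⬝ᵥ w| ≤ ‖M‖ * Rinf * max R1 1 := by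
  have h0 : 0 ≤ ∑ x, |w x| := Finset.sum_nonneg fun _ _ => abs_nonneg _
  calc |(M *ᵥ u) ⬝ᵥ w| ≤ ‖M‖ * ‖u‖ * ∑ x, |w x| := abs_mulVec_dotProduct_le M u w
    _ ≤ ‖M‖ * Rinf * max R1 1 := by
        refine mul_le_mul (mul_le_mul_of_nonneg_left hu (norm_nonneg _)) (hw.trans (le_max_left _ _)) h0 ?_
        exact mul_nonneg (norm_nonneg _) hRinf

/-- the sup norm of a propagated direction: `‖Mu‖_∞ ≤ ‖M‖·R_∞ ≤ ‖M‖·R_∞·max(R₁,1)`. [cite: BalabanImbrieJaffe1988, §5.14 p.310] -/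
theorem norm_mulVec_le_of_mem (M : Matrix n n ℝ) {Rinf : ℝ} (R1 : ℝ) (hRinf : 0 ≤ Rinf) {u : n → ℝ} (hu : ‖u‖ ≤ Rinf) :
    ‖M *ᵥ u‖ ≤ ‖M‖ * Rinf * max R1 1 :=
  calc ‖M *ᵥ u‖ ≤ ‖M‖ * ‖u‖ := norm_mulVec_le' M u
    _ ≤ ‖M‖ * Rinf := mul_le_mul_of_nonneg_left hu (norm_nonneg _)
    _ ≤ ‖M‖ * Rinf * max R1 1 := le_mul_of_one_le_right (mul_nonneg (norm_nonneg _) hRinf) (le_max_right _ _)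

end Dir

/-! ## §2  The head theorem with the two pieces of record -/

section Law

variable {ι : Type} [Fintype ι] {κ : Type} [LinearOrder κ] {β : Type} [DecidableEq β]
variable {α I : Type} [Fintype α] [DecidableEq α] [Fintype I] [DecidableEq I]
  {blk : α → I} {Δ : Matrix α α ℝ} {ℱ : α → ℝ} {W : Finset I}

/-- **THE HEAD THEOREM OF ROW C2.Claim@312 WITH THE COVARIANCE PIECES OF RECORD** — `ineq312_remainder_bdry` for
`P = Bool`, `Cov = covSplit blk Δ W R` (`false ↦ C_{loc,R}` non-triggering, `true ↦ C_{tail,R}` triggering),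
`reg ≡ ∅`, `ρ ≡ 1`, `ρ₀ = 2`, `Dir = {u : ‖u‖_∞ ≤ R_∞ ∧ Σ|u| ≤ R₁}`, `B′ p = ‖Cov p‖R_∞max(R₁,1)`; C1 reduced to the two
numbers `‖C_{loc,R}‖R_∞max(R₁,1) ≤ B_ℓ` and `‖C_{tail,R}‖R_∞max(R₁,1) ≤ θ_w` (print's `e^{−cr(e_k)}`); C2–C5 as in the head.
[cite: BalabanImbrieJaffe1988, §5.14 p.312 (estimate preceding (5.14.5)); p.310] -/
theorem ineq312_remainder_bdry_covSplit (hPD : (prec blk Δ W (corner ℝ W)).PosDef) (R : ℕ) {Rinf R1 : ℝ}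
    (hRinf : 0 ≤ Rinf) {c : ι → ℝ}
    {legs : ι → List ({x : α // blk x ∈ W} → ℝ)} {obs : κ → List ({x : α // blk x ∈ W} → ℝ)} {M : ℕ}
    {χ : ({x : α // blk x ∈ W} → ℝ) → ℝ} {oc : κ → Finset β} {vc : ι → Finset β}
    {cV : ι → ℝ} {Bl θ θv θw ηχ Kχ : ℝ} {Λ : Finset κ → ℝ} {N₀ : ℕ}
    (hθ0 : 0 < θ) (hθ1 : θ ≤ 1) (hBl : 1 ≤ Bl) (hcV0 : ∀ m, 0 ≤ cV m)
    (hη0 : 0 ≤ ηχ) (hη1 : ηχ ≤ 1) (hθv : 0 < θv) (hθv1 : θv ≤ 1) (hθw : 0 < θw) (hθw1 : θw ≤ 1)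
    (hsrc : ∑ x, |src blk ℱ W x| ≤ R1)
    (hcV : ∀ m, |c m| ≤ cV m)
    (hobs : ∀ j, ∀ w ∈ obs j, ‖w‖ ≤ Rinf ∧ ∑ x, |w x| ≤ R1)
    (hlegs : ∀ m, ∀ w ∈ legs m, ‖w‖ ≤ Rinf ∧ ∑ x, |w x| ≤ R1)
    (hBl' : ‖covSplit blk Δ W R false‖ * Rinf * max R1 1 ≤ Bl)
    (hθw' : ‖covSplit blk Δ W R true‖ * Rinf * max R1 1 ≤ θw)
    (hvert : ∀ m, cV m * Bl ^ (legs m).length ≤ θv * θ ^ (vc m).card)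
    (hN : ∀ p, ∀ u : {x : α // blk x ∈ W} → ℝ, ‖u‖ ≤ Rinf ∧ ∑ x, |u x| ≤ R1 →
      (∑ m, ((range (legs m).length).filter fun j =>
        (covSplit blk Δ W R p *ᵥ u) ⬝ᵥ (legs m).getD j 0 ≠ 0).card) ≤ N₀)
    (hKχ : 0 ≤ Kχ) (hΛ : ∀ O, 0 ≤ Λ O)
    (hE : ∀ O : Finset κ, ∀ t ∈ expand (covSplit blk Δ W R) (fun p => p) (src blk ℱ W) c legs obs M 0 O,
      t.consts = 0 →
      |∫ φ, ((t.groups.map fun h => (h.pend : Multiset _)).sum.map fun w => φ ⬝ᵥ w).prod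
          * (dlist t.dirs χ φ * vexp c legs φ) ∂(fieldLaw blk Δ ℱ W)|
        ≤ Kχ * (t.dirs.map fun z => ηχ * ‖z‖).prod * Λ O)
    (bdry : Finset κ)
    (hbeat : ∀ O : Finset κ, ∀ t ∈ expand (covSplit blk Δ W R) (fun p => p) (src blk ℱ W) c legs obs M 0 O,
      t.consts = 0 → ∀ X ∈ t.groups,
      max ηχ (max (θv ^ M) θw) * ∏ j ∈ X.lab.filter (fun j => j ∉ bdry), Bl ^ (obs j).length ≤ 1) :
    BIJ88Sect5StatementsPart4.Ineq312 (remSys κ β)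
      (fun OX => remAt (prec blk Δ W (corner ℝ W)) (covSplit blk Δ W R) (fun p => p) (src blk ℱ W) c legs obs M χ
          oc vc (fun _ => (∅ : Finset β)) [] 0 OX.1 OX.2
        / ∫ φ, weight (prec blk Δ W (corner ℝ W)) φ * source (src blk ℱ W) φ)
      (fun OX => Kχ * Λ OX.1 * (max 1 (2 * ((phi0 legs obs M OX.1 + N₀ : ℕ) : ℝ))) ^ phi0 legs obs M OX.1)
      (fun OX => ∏ j ∈ OX.1.filter (fun j => j ∈ bdry), Bl ^ (obs j).length)
      (fun OX => nfreeOf oc OX.2) θ 1 := by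
  have hmax : 0 < max R1 1 := lt_of_lt_of_le zero_lt_one (le_max_right _ _)
  refine ineq312_remainder_bdry (Dir := {u | ‖u‖ ≤ Rinf ∧ ∑ x, |u x| ≤ R1})
    (B' := fun p => ‖covSplit blk Δ W R p‖ * Rinf * max R1 1) (ρ := fun _ => 1) (ρ₀ := 2)
    (reg := fun _ => (∅ : Finset β)) (trig := fun p => p)
    hPD hθ0 hθ1 hBl (fun p => ?_) (fun _ => zero_le_one) hcV0 hη0 hη1 hθv hθv1 hθw hθw1
    (fun p u hu w hw => ?_) (fun p u hu => ?_) (fun p u hu => ?_) hcV (fun j w hw => hobs j w hw)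
    (fun m w hw => hlegs m w hw) (fun p hp => ?_) (fun p hp => ?_) hvert zero_le_two (fun u _ => ?_)
    (fun p u hu => hN p u hu) hKχ hΛ hE bdry hbeat
  · exact mul_nonneg (mul_nonneg (norm_nonneg _) hRinf) hmax.le
  · rw [mul_one]; exact bracket_le_of_mem _ hRinf hu.1 hw.2
  · rw [mul_one]; exact bracket_le_of_mem _ hRinf hu.1 hsrc
  · rw [mul_one]; exact norm_mulVec_le_of_mem _ R1 hRinf hu.1
  · subst hp; exact ⟨hBl', rfl⟩
  · subst hp; rw [card_empty, pow_zero, mul_one]; exact hθw'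
  · calc _ ≤ ∑ _p : Bool, (1 : ℝ) :=
          Finset.sum_le_sum_of_subset_of_nonneg (filter_subset _ _) fun _ _ _ => zero_le_one
      _ = 2 := by norm_num

/-! ## §3  The located display on the law with `hCov` discharged -/

/-- **THE LOCATED DISPLAY ON THE LAW FOR THE PIECES OF RECORD** — `BIJ88WalkLocatedDisplay312.located_display_fieldLaw`
with `Cov = covSplit blk Δ W R` and its hypothesis `Σ_p Cov p = prec⁻¹` DISCHARGED by
`BIJ88WalkCovarianceSplit310.sum_covSplit` (p. 312 first display, located form):
`𝔼[Π_{j∈K}Π_{w∈obs j}(Φ·w)·χe^{−V}] = Σ_{O⊆K}(Σ_{π}Π_{Q∈π}flBlock Q)·Σ_𝒳 remAt(O,𝒳)/Z`.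
[cite: BalabanImbrieJaffe1988, §5.14 p.312 (first display); p.310] -/
theorem located_display_fieldLaw_covSplit (hPD : (prec blk Δ W (corner ℝ W)).PosDef) (R : ℕ) {c : ι → ℝ}
    {legs : ι → List ({x : α // blk x ∈ W} → ℝ)} {obs : κ → List ({x : α // blk x ∈ W} → ℝ)} {M : ℕ}
    {χ : ({x : α // blk x ∈ W} → ℝ) → ℝ} (oc : κ → Finset β) (vc : ι → Finset β)
    (hχ : ∀ D : List ({x : α // blk x ∈ W} → ℝ), ContDiff ℝ 1 (dlist D χ))
    (h0 : ∀ D : List ({x : α // blk x ∈ W} → ℝ), ∃ K, ∀ φ, ‖dlist D χ φ * vexp c legs φ‖ ≤ K) (K : Finset κ) :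
    ∫ φ, (((K.val.map fun j => (obs j : Multiset ({x : α // blk x ∈ W} → ℝ))).sum.map fun w => φ ⬝ᵥ w).prod
        * (χ φ * vexp c legs φ)) ∂(fieldLaw blk Δ ℱ W)
      = ∑ O ∈ K.powerset,
          (∑ π ∈ setPartitions (K \ O),
              ∏ Q ∈ π, flBlock (covSplit blk Δ W R) (fun p => p) (src blk ℱ W) c legs obs M Q)
            * ∑ 𝒳 ∈ ((expand (covSplit blk Δ W R) (fun p => p) (src blk ℱ W) c legs obs M 0 O).map
                (rloc oc vc (fun _ => (∅ : Finset β)))).toFinset,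
                remAt (prec blk Δ W (corner ℝ W)) (covSplit blk Δ W R) (fun p => p) (src blk ℱ W) c legs obs M χ
                    oc vc (fun _ => (∅ : Finset β)) [] 0 O 𝒳
                  / ∫ φ, weight (prec blk Δ W (corner ℝ W)) φ * source (src blk ℱ W) φ :=
  located_display_fieldLaw (trig := fun p => p) (M := M) hPD oc vc (fun _ => (∅ : Finset β)) hχ h0
    (sum_covSplit blk Δ W hPD R) K

/-! ## §4  The head with the two pieces of record and the sup letter alone -/

omit [Fintype I] in
/-- **THE MOMENT LETTERS FROM THE NORMS**: for a leg `w` with `‖w‖_∞ ≤ R_∞`, `Σ|w| ≤ R₁`: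
`|w·(prec⁻¹ℱ|_W)| ≤ ‖prec⁻¹‖·‖ℱ|_W‖_∞·R₁` and `w·prec⁻¹w ≤ ‖prec⁻¹‖·R_∞·R₁` (`ℓ^∞`-operator norm).
[cite: BalabanImbrieJaffe1988, §5.14 p.312] -/
theorem moment_letters_of_norm (A : Matrix {x : α // blk x ∈ W} {x : α // blk x ∈ W} ℝ) (f : {x : α // blk x ∈ W} → ℝ)
    {Rinf R1 : ℝ} {w : {x : α // blk x ∈ W} → ℝ} (hw : ‖w‖ ≤ Rinf ∧ ∑ x, |w x| ≤ R1) :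
    |w ⬝ᵥ (A⁻¹ *ᵥ f)| ≤ ‖A⁻¹‖ * ‖f‖ * R1 ∧ w ⬝ᵥ (A⁻¹ *ᵥ w) ≤ ‖A⁻¹‖ * Rinf * R1 := by
  have h0 : 0 ≤ ∑ x, |w x| := Finset.sum_nonneg fun _ _ => abs_nonneg _
  constructor
  · rw [dotProduct_comm]
    calc |(A⁻¹ *ᵥ f) ⬝ᵥ w| ≤ ‖A⁻¹‖ * ‖f‖ * ∑ x, |w x| := abs_mulVec_dotProduct_le _ _ _
      _ ≤ ‖A⁻¹‖ * ‖f‖ * R1 := mul_le_mul_of_nonneg_left hw.2 (mul_nonneg (norm_nonneg _) (norm_nonneg _))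
  · rw [dotProduct_comm]
    calc (A⁻¹ *ᵥ w) ⬝ᵥ w ≤ |(A⁻¹ *ᵥ w) ⬝ᵥ w| := le_abs_self _
      _ ≤ ‖A⁻¹‖ * ‖w‖ * ∑ x, |w x| := abs_mulVec_dotProduct_le _ _ _
      _ ≤ ‖A⁻¹‖ * Rinf * R1 :=
          mul_le_mul (mul_le_mul_of_nonneg_left hw.1 (norm_nonneg _)) hw.2 h0
            (mul_nonneg (norm_nonneg _) ((norm_nonneg _).trans hw.1))

/-- **THE HEAD THEOREM WITH THE PIECES OF RECORD AND THE SUP LETTER ALONE**: `ineq312_remainder_bdry_covSplit` with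
the expectation clause `hE` REPLACED by the sup letter `|(Π_D∂)χ·e^{−V}| ≤ K_χΠ_{z∈D}(η_χ‖z‖)` (continuous `(Π_D∂)χ`);
the moment letter is DISCHARGED on the law (`BIJ88WalkRemainderMoments312.remainder_moment_le`) with
`μ_* = ‖prec⁻¹‖·‖ℱ|_W‖_∞·R₁`, `v_* = ‖prec⁻¹‖·R_∞·R₁`, so that
`Λ_O = Σ_{N≤Φ₀(O)} 2^N(μ_*^N + 1 + v_*^N(2N−1)‼)` appears in `c(F)`. [cite: BalabanImbrieJaffe1988, §5.14 p.312 (estimate preceding (5.14.5)); p.310] -/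
theorem ineq312_remainder_bdry_covSplit_of_sup (hPD : (prec blk Δ W (corner ℝ W)).PosDef) (R : ℕ) {Rinf R1 : ℝ}
    (hRinf : 0 ≤ Rinf) (hR1 : 0 ≤ R1) {c : ι → ℝ}
    {legs : ι → List ({x : α // blk x ∈ W} → ℝ)} {obs : κ → List ({x : α // blk x ∈ W} → ℝ)} {M : ℕ}
    {χ : ({x : α // blk x ∈ W} → ℝ) → ℝ} {oc : κ → Finset β} {vc : ι → Finset β}
    {cV : ι → ℝ} {Bl θ θv θw ηχ Kχ : ℝ} {N₀ : ℕ}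
    (hθ0 : 0 < θ) (hθ1 : θ ≤ 1) (hBl : 1 ≤ Bl) (hcV0 : ∀ m, 0 ≤ cV m)
    (hη0 : 0 ≤ ηχ) (hη1 : ηχ ≤ 1) (hθv : 0 < θv) (hθv1 : θv ≤ 1) (hθw : 0 < θw) (hθw1 : θw ≤ 1)
    (hsrc : ∑ x, |src blk ℱ W x| ≤ R1)
    (hcV : ∀ m, |c m| ≤ cV m)
    (hobs : ∀ j, ∀ w ∈ obs j, ‖w‖ ≤ Rinf ∧ ∑ x, |w x| ≤ R1)
    (hlegs : ∀ m, ∀ w ∈ legs m, ‖w‖ ≤ Rinf ∧ ∑ x, |w x| ≤ R1)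
    (hBl' : ‖covSplit blk Δ W R false‖ * Rinf * max R1 1 ≤ Bl)
    (hθw' : ‖covSplit blk Δ W R true‖ * Rinf * max R1 1 ≤ θw)
    (hvert : ∀ m, cV m * Bl ^ (legs m).length ≤ θv * θ ^ (vc m).card)
    (hN : ∀ p, ∀ u : {x : α // blk x ∈ W} → ℝ, ‖u‖ ≤ Rinf ∧ ∑ x, |u x| ≤ R1 →
      (∑ m, ((range (legs m).length).filter fun j =>
        (covSplit blk Δ W R p *ᵥ u) ⬝ᵥ (legs m).getD j 0 ≠ 0).card) ≤ N₀)
    (hKχ : 0 ≤ Kχ) (hχc : ∀ D : List ({x : α // blk x ∈ W} → ℝ), Continuous (dlist D χ))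
    (hK : ∀ (D : List ({x : α // blk x ∈ W} → ℝ)) φ,
      |dlist D χ φ * vexp c legs φ| ≤ Kχ * (D.map fun z => ηχ * ‖z‖).prod)
    (bdry : Finset κ)
    (hbeat : ∀ O : Finset κ, ∀ t ∈ expand (covSplit blk Δ W R) (fun p => p) (src blk ℱ W) c legs obs M 0 O,
      t.consts = 0 → ∀ X ∈ t.groups,
      max ηχ (max (θv ^ M) θw) * ∏ j ∈ X.lab.filter (fun j => j ∉ bdry), Bl ^ (obs j).length ≤ 1) :
    BIJ88Sect5StatementsPart4.Ineq312 (remSys κ β)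
      (fun OX => remAt (prec blk Δ W (corner ℝ W)) (covSplit blk Δ W R) (fun p => p) (src blk ℱ W) c legs obs M χ
          oc vc (fun _ => (∅ : Finset β)) [] 0 OX.1 OX.2
        / ∫ φ, weight (prec blk Δ W (corner ℝ W)) φ * source (src blk ℱ W) φ)
      (fun OX => Kχ * (∑ N ∈ range (phi0 legs obs M OX.1 + 1),
          2 ^ N * ((‖(prec blk Δ W (corner ℝ W))⁻¹‖ * ‖src blk ℱ W‖ * R1) ^ N
            + (1 + (‖(prec blk Δ W (corner ℝ W))⁻¹‖ * Rinf * R1) ^ N * ((2 * N - 1).doubleFactorial : ℝ))))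
        * (max 1 (2 * ((phi0 legs obs M OX.1 + N₀ : ℕ) : ℝ))) ^ phi0 legs obs M OX.1)
      (fun OX => ∏ j ∈ OX.1.filter (fun j => j ∈ bdry), Bl ^ (obs j).length)
      (fun OX => nfreeOf oc OX.2) θ 1 := by
  set A := prec blk Δ W (corner ℝ W) with hA
  have hμs : 0 ≤ ‖A⁻¹‖ * ‖src blk ℱ W‖ * R1 := mul_nonneg (mul_nonneg (norm_nonneg _) (norm_nonneg _)) hR1
  have hvs : 0 ≤ ‖A⁻¹‖ * Rinf * R1 := mul_nonneg (mul_nonneg (norm_nonneg _) hRinf) hR1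
  have hΛ : ∀ O : Finset κ, 0 ≤ ∑ N ∈ range (phi0 legs obs M O + 1),
      2 ^ N * ((‖A⁻¹‖ * ‖src blk ℱ W‖ * R1) ^ N + (1 + (‖A⁻¹‖ * Rinf * R1) ^ N * ((2 * N - 1).doubleFactorial : ℝ))) :=
    fun O => Finset.sum_nonneg fun N _ => by positivity
  exact ineq312_remainder_bdry_covSplit hPD R hRinf hθ0 hθ1 hBl hcV0 hη0 hη1 hθv hθv1 hθw hθw1 hsrc hcV hobs hlegs
    hBl' hθw' hvert hN hKχ hΛ
    (fun O => remainder_expectation_le_of_sup blk Δ ℱ W hPD hKχ hη0 hμs hvs hχc hK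
      (fun j w hw => moment_letters_of_norm A (src blk ℱ W) (hobs j w hw))
      (fun m w hw => moment_letters_of_norm A (src blk ℱ W) (hlegs m w hw)) O)
    bdry hbeat

end Law

/-! ## §5  Kernel non-vacuity certificate: every binder of §4 inhabited on a one-site toy -/

section Toy

open BIJ88WickDerivatives305 (dlist_nil)
open BIJ88VertexIbp311 (vpoly)
open BIJ88WalkIneq312NonVacuity (toy_prec_posDef dlist_cons_const)

/-- on one cube the inter-cube part vanishes, so the tail piece of record is `0` (`R = 1`).
[cite: BalabanImbrieJaffe1988, §5.14 p.310] -/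
theorem covSplit_true_toy_eq_zero :
    covSplit (fun _ : Unit => ()) (1 : Matrix Unit Unit ℝ) ({()} : Finset Unit) 1 true = 0 := by
  letI : DecidableEq {x : Unit // (fun _ : Unit => ()) x ∈ ({()} : Finset Unit)} :=
    fun a b => Classical.propDecidable (a = b)
  have hN : offDiag (fun x : {x : Unit // (fun _ : Unit => ()) x ∈ ({()} : Finset Unit)} => (fun _ : Unit => ()) x.1)
      (prec (fun _ : Unit => ()) (1 : Matrix Unit Unit ℝ) ({()} : Finset Unit) (corner ℝ ({()} : Finset Unit))) = 0 := by
    ext x y; rw [offDiag_apply, if_pos rfl, Matrix.zero_apply]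
  simp only [covSplit, cond_true, tailPiece, stepOp, pow_one, hN, Matrix.mul_zero, Matrix.zero_mul]

/-- **NON-VACUITY OF `ineq312_remainder_bdry_covSplit_of_sup`**: one site (`α = I = κ = β = Unit`, `W = {()}`,
`Δ = 1`, `ℱ = 0`), one observable with the genuine leg `e = 1`, no vertex (`ι = Fin 0`), `χ ≡ 1`, `R = 1`,
`R_∞ = R₁ = 1`, `θ = θ_v = θ_w = η_χ = K_χ = 1`, `B_ℓ = max(1, ‖C_{loc,1}‖)`, `N₀ = 0`, `M = 1`, `bdry = {()}` — EVERY
hypothesis of §4 discharged by the kernel (the tail piece is `0`, `covSplit_true_toy_eq_zero`); a consistency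
certificate, nothing of print is modelled by the toy. [cite: BalabanImbrieJaffe1988, §5.14 p.312 (estimate preceding (5.14.5))] -/
theorem ineq312_remainder_bdry_covSplit_of_sup_toy :
    BIJ88Sect5StatementsPart4.Ineq312 (remSys Unit Unit)
      (fun OX => remAt (prec (fun _ : Unit => ()) (1 : Matrix Unit Unit ℝ) ({()} : Finset Unit) (corner ℝ ({()} : Finset Unit)))
          (covSplit (fun _ : Unit => ()) (1 : Matrix Unit Unit ℝ) ({()} : Finset Unit) 1) (fun p => p)
          (src (fun _ : Unit => ()) (0 : Unit → ℝ) ({()} : Finset Unit)) (fun _ : Fin 0 => (0 : ℝ)) (fun _ : Fin 0 => [])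
          (fun _ : Unit => [fun _ => (1 : ℝ)]) 1 (fun _ => (1 : ℝ)) (fun _ : Unit => (∅ : Finset Unit))
          (fun _ : Fin 0 => (∅ : Finset Unit)) (fun _ => (∅ : Finset Unit)) [] 0 OX.1 OX.2
        / ∫ φ, weight (prec (fun _ : Unit => ()) (1 : Matrix Unit Unit ℝ) ({()} : Finset Unit) (corner ℝ ({()} : Finset Unit))) φ
            * source (src (fun _ : Unit => ()) (0 : Unit → ℝ) ({()} : Finset Unit)) φ)
      (fun OX => (1 : ℝ) * (∑ N ∈ range (phi0 (fun _ : Fin 0 => ([] : List ({x : Unit // (fun _ : Unit => ()) x ∈ ({()} : Finset Unit)} → ℝ)))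
            (fun _ : Unit => [fun _ => (1 : ℝ)]) 1 OX.1 + 1),
          2 ^ N * ((‖(prec (fun _ : Unit => ()) (1 : Matrix Unit Unit ℝ) ({()} : Finset Unit) (corner ℝ ({()} : Finset Unit)))⁻¹‖
              * ‖src (fun _ : Unit => ()) (0 : Unit → ℝ) ({()} : Finset Unit)‖ * 1) ^ N
            + (1 + (‖(prec (fun _ : Unit => ()) (1 : Matrix Unit Unit ℝ) ({()} : Finset Unit) (corner ℝ ({()} : Finset Unit)))⁻¹‖
              * 1 * 1) ^ N * ((2 * N - 1).doubleFactorial : ℝ))))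
        * (max 1 (2 * ((phi0 (fun _ : Fin 0 => ([] : List ({x : Unit // (fun _ : Unit => ()) x ∈ ({()} : Finset Unit)} → ℝ)))
            (fun _ : Unit => [fun _ => (1 : ℝ)]) 1 OX.1 + 0 : ℕ) : ℝ)))
          ^ phi0 (fun _ : Fin 0 => ([] : List ({x : Unit // (fun _ : Unit => ()) x ∈ ({()} : Finset Unit)} → ℝ)))
            (fun _ : Unit => [fun _ => (1 : ℝ)]) 1 OX.1)
      (fun OX => ∏ _j ∈ OX.1.filter (fun j => j ∈ ({()} : Finset Unit)),
        (max 1 (‖covSplit (fun _ : Unit => ()) (1 : Matrix Unit Unit ℝ) ({()} : Finset Unit) 1 false‖ * 1 * max 1 1))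
          ^ ([fun _ : {x : Unit // (fun _ : Unit => ()) x ∈ ({()} : Finset Unit)} => (1 : ℝ)]).length)
      (fun OX => nfreeOf (fun _ : Unit => (∅ : Finset Unit)) OX.2) 1 1 := by
  have hcard : Fintype.card {x : Unit // (fun _ : Unit => ()) x ∈ ({()} : Finset Unit)} ≤ 1 :=
    (Fintype.card_subtype_le _).trans (by simp)
  have hsrc : src (fun _ : Unit => ()) (0 : Unit → ℝ) ({()} : Finset Unit) = 0 := by funext x; simp [src]
  -- the leg `e = 1`: `‖e‖_∞ = 1`, `Σ|e| = #sites ≤ 1`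
  have he : ‖(fun _ : {x : Unit // (fun _ : Unit => ()) x ∈ ({()} : Finset Unit)} => (1 : ℝ))‖ ≤ 1 :=
    (pi_norm_const_le (1 : ℝ)).trans_eq norm_one
  have he1 : ∑ x : {x : Unit // (fun _ : Unit => ()) x ∈ ({()} : Finset Unit)},
      |(fun _ : {x : Unit // (fun _ : Unit => ()) x ∈ ({()} : Finset Unit)} => (1 : ℝ)) x| ≤ 1 := by
    rw [sum_const, card_univ, nsmul_eq_mul, abs_one, mul_one]; exact_mod_cast hcard
  -- the interaction factor without vertices is `1`
  have hv : ∀ φ : {x : Unit // (fun _ : Unit => ()) x ∈ ({()} : Finset Unit)} → ℝ,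
      vexp (fun _ : Fin 0 => (0 : ℝ)) (fun _ : Fin 0 => []) φ = 1 := fun φ => by simp [vexp, vpoly]
  refine ineq312_remainder_bdry_covSplit_of_sup (β := Unit) toy_prec_posDef 1 zero_le_one zero_le_one
    (cV := fun _ => 0) one_pos le_rfl (le_max_left _ _) (fun m => m.elim0) zero_le_one le_rfl one_pos le_rfl one_pos
    le_rfl ?_ (fun m => m.elim0) (fun _ w hw => ?_) (fun m => m.elim0) (le_max_right _ _) ?_ (fun m => m.elim0)
    (fun _ u _ => by simp) zero_le_one (fun D => ?_) (fun D φ => ?_) ({()} : Finset Unit) (fun O t _ _ X _ => by simp)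
  · rw [hsrc]; simp
  · rw [List.mem_singleton] at hw; subst hw; exact ⟨he, he1⟩
  · rw [covSplit_true_toy_eq_zero, norm_zero, zero_mul, zero_mul]; exact zero_le_one
  · cases D with
    | nil => rw [dlist_nil]; exact continuous_const
    | cons z D => rw [dlist_cons_const]; exact continuous_const
  · cases D with
    | nil => rw [dlist_nil, hv, List.map_nil, List.prod_nil]; simp
    | cons z D =>
      rw [dlist_cons_const, Pi.zero_apply, zero_mul, abs_zero]
      exact mul_nonneg zero_le_one (List.prod_nonneg fun x hx => by
        obtain ⟨z, -, rfl⟩ := List.mem_map.1 hx; exact mul_nonneg zero_le_one (norm_nonneg z))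

end Toy

end Literature.MathematicalPhysics.QuantumFieldTheory.BalabanImbrieJaffe1984to88.BIJ88WalkIneq312CovSplit

end
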